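import Summits.QuantumFields.YangMills.Theorems.BalabanUVNodesN21ThresholdMixtureTowerOps
import Literature.MathematicalPhysics.QuantumFieldTheory.Balaban1983to89.Node00.StepWeightsAtThresholds

/-!
# YM-DAG node N21 (= NE7c) — THE THRESHOLD MIXTURE, PART 18: THE MIXTURE ROAD AT def-T's LETTERS OF RECORD — the integral over a family of
# threshold letters of the SHARP T-step of record at letters (`Node00.tstepOfRecordAt`, with the step weights at letters `Node00.wOfRecordAt`) IS the
# T-step at the integrated front factor and the RESUMMED integrated label weights, the residual `ζ` riding along

Track A of `YM-PLAN.md` (cell `pub-ymgap`, HUMAN RULING D-0062), node **N21**; R141 (C) fan-out seat `pub-ymgap-dag-n21-e` (s3 = ALTERNATIVE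
CURRENCY), generation 7, file 18.  Lane K3⁗ `SpineGivenEndpointR13Sep` = stmt-QuantumFields-20292 (`--kind proof --supports … --as helper`).
Imports this seat's file 15 `…N21ThresholdMixtureTowerOps` (p500803: `integral_texpASucc_prod_eq`) and node00-def-T's «THRESHOLDS AS A LETTER» leaf
`Node00/StepWeightsAtThresholds.lean` (g14 INTENT-19, pub-ymgap INBOX l.17110; answers dag-n21-d's LOCATED-THRESHOLD-PINS l.16409 and this seat's trigger
t16): `chiSeqOfRecordAt`, `aWeightAt`, `bWeightAt`, `ωOfRecordAt`, `ThresholdLetter`, `wOfRecordAt`, `tstepOfRecordAt`, read BY NAME.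

WHAT IS TYPED AND PROVED (all [folklore]: `integral_finsetSum`, `integral_mul_const`, file 15's Fubini lemma at the new names).
* §1 `integral_resumWeights_eq` (def-T's resummation `resumWeights σ` along the index map (3.5)∕(3.20) is a finite sum over labels ⇒ commutes with the
  integral over any letter family) · `integral_ωOfRecordAt_eq` (the label weight at letters `ω|_{ε,δ′} = a|_ε · b|_{δ′} · ζ`: the residual `ζ` is
  threshold-free as a separate argument and RIDES ALONG — `∫ ω|_{ε_θ,δ′_θ} dμ = (∫ a|_{ε_θ}·b|_{δ′_θ} dμ)·ζ`) · `integral_wOfRecordAt_eq` (the integrated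
  step weights at letters ARE the resummed integrated label weights).
* §2 `integral_tstepOfRecordAt_eq` (ONE block: weights' letters mixed, front factor at a fixed letter — 15 §4 at letters) · ★ `integral_tstepOfRecordAt_prod_eq` (SEPARATED BLOCKS at def-T's names: the old front factor `χ_k|_{Θ_{θ₁}}` reads block 1, a generic
  step-weight family `w_{θ₂} : StepWeightsOfRecord …` reads block 2; `∫ tstepOfRecordAt (Θ θ₁) (w θ₂) d(μ₁ ⊗ μ₂) = texpASucc avg (∫χ_k|_{Θ_θ} dμ₁) T (∫ w_θ dμ₂)`;
  `|χ| ≤ 1` is def-T's `abs_chiSeqOfRecordAt_le_one`, `|w| ≤ 1` displayed) · ★★ `integral_tstepOfRecordAt_wOfRecordAt_prod_eq` (block 2 = the step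
  weights AT LETTERS `wOfRecordAt (Θ′ θ₂) (Δ θ₂) ζ`, `|w| ≤ 1` by def-T's `abs_wOfRecordAt_le_one` under the displayed ζ-size law `IsZetaAbsLeOne`: the
  integrated T-step is `texpASucc` at the integrated front factor and `resumWeights σOfRecord (∫ a|·b| dμ₂ · ζ)`).
* §3 `aWeightAt_eq_prod_fac_smallInd` · `bWeightAt_eq_prod_fac_smallInd` · ★ `aWeightAt_mul_bWeightAt_eq_prod_fac_disjSum` (14b's three sharp-product
  identities with the thresholds LETTERS: a scalar-letter family is the CONSTANT-PER-KIND sub-family `Sum.elim (· ↦ ε η²) (· ↦ δ′)` of the per-occurrence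
  threshold vectors of 14a∕14b; 14b's record versions are the instances at def-T's letters of record).
The record is the DIAGONAL instance (Dirac families at `epsLetterOfRecord` ∕ `twoDeltaLetterOfRecord`: def-T's `rfl` bridges `tstepOfRecord_eq_at`,
`wOfRecord_eq_at`); file 15 §4 `integral_tstepOfRecord_eq` is the one-block case with the front factor at print's pin.

HONEST SCOPE OF THE LETTERS (located, not typed).  def-T's `ThresholdLetter = RunParams → (ℕ → ℝ) → ℕ → ℝ` is ONE real per (run, coupling sequence,
level): the families typable here are PER-LEVEL multiplier families (and the selection road's candidate GRIDS, `T4ShellMeasure` §7) — the value-level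
identity above holds for all of them.  The mixture road's SHELL argument wants ONE multiplier PER OCCURRENCE (per cube; lens census (p)∕(dd), (O-mix-3)):
that needs VECTOR letters `ε : cubes → ℝ` inside `chiSeqOfRecordAt`∕`chiFactorAt`, which this seat's 13b∕14a∕14b hold as explicit per-cube products
(`chi218_record_eq_prod_smallInd`, `aWeight_mul_bWeight_eq_prod_fac_disjSum`, `commonBox_average_tStepLabel_eq_profile`) — §3 types the junction
«letters = constant-per-kind threshold vectors»: the per-level families are a measure-zero DIAGONAL of the common box, not a substitute for it.  Through
def-R's (0.3) quotient the mixture does NOT commute at the value level (file 16 `quotient_not_additive`); nothing here touches `rstepOfSel`.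
HONEST FRAMING.  Kernel bookkeeping (Fubini, finite sums) over def-T's letters; nothing of Bałaban's asserted; (M1) for print's deterministic sharp
procedure untouched; NE7c NOT PRINTED ∕ NOT proved; N21 NOT discharged; counts unmoved (typed 28∕28 · discharged 5∕27, A 5∕28); one finite 𝕋⁴ at
fixed ε — NOT ℝ⁴ ∕ OS ∕ mass gap ∕ Clay.  No `sorry`∕`axiom`∕`def`∕`instance`∕`notation`.
-/

noncomputable section

open MeasureTheory Set
open scoped BigOperators ENNReal

namespace Summit.QuantumFields.YangMills.Theorems.N21ThresholdMixtureAtLetters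

open Literature.MathematicalPhysics.QuantumFieldTheory.Balaban1983to89
open Literature.MathematicalPhysics.QuantumFieldTheory.Balaban1983to89.B14.Eq218Concrete
open Literature.MathematicalPhysics.QuantumFieldTheory.Balaban1983to89.T4AveragingDisintegration (avgKernel)
open Literature.MathematicalPhysics.QuantumFieldTheory.Balaban1983to89.Node00
open Summit.QuantumFields.YangMills.Theorems.N21ThresholdMixtureTowerOps (integral_texpASucc_eq integral_texpASucc_prod_eq)

/-! ## §1  Resummation along the index map and the residual `ζ` commute with the integral over a letter family -/

section Resum

variable {P : Params} {G : Type*} {α : Type*} {D : ℕ → Set (Set α)} {k : ℕ} {Lb : Type*} [Fintype Lb]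
  {Θ : Type*} [MeasurableSpace Θ]

/-- **RESUMMATION COMMUTES WITH THE LETTER INTEGRAL.**  def-T's `resumWeights σ ω (s′)(U,V′) = Σ_{t : σ (init s′) t = s′} ω (init s′) t (U,V′)` is a finite
sum over labels, so for a `θ`-family of label weights integrable label by label, `∫ resumWeights σ ω_θ dμ = resumWeights σ (∫ ω_θ dμ)`.
[cite: Balaban1988Convergent, (3.5) p.265, (3.20) p.269 (bookkeeping)] -/
theorem integral_resumWeights_eq (μΘ : Measure Θ) (σ : Seq D k → Lb → Seq D (k + 1))
    (ω : Θ → Seq D k → Lb → GaugeField P k G → GaugeField P (k + 1) G → ℝ) (s' : Seq D (k + 1)) (U : GaugeField P k G)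
    (V' : GaugeField P (k + 1) G) (hint : ∀ t, Integrable (fun θ => ω θ s'.init t U V') μΘ) :
    ∫ θ, resumWeights σ (ω θ) s' U V' ∂μΘ = resumWeights σ (fun s t U V => ∫ θ, ω θ s t U V ∂μΘ) s' U V' := by
  simp only [resumWeights]
  exact integral_finsetSum _ fun t _ => hint t

end Resum

section AtLetters

open T4Continuum

variable (F : T4Family) (N : ℕ) [NeZero N] (ν : Stage7Numerics) (M : ℕ)
variable {Θ₁ Θ₂ : Type*} [MeasurableSpace Θ₁] [MeasurableSpace Θ₂]

/-- **THE RESIDUAL `ζ` RIDES ALONG.**  The label weight at letters is `a|_ε(P)(V′) · b|_{δ′}(P,Q)(U,V′) · ζ(R,S)(U,V′)` with `ζ` a separate, threshold-free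
argument (def-T's `ωOfRecordAt`): for letter families `ε_θ`, `δ′_θ`, `∫ ω|_{ε_θ,δ′_θ} dμ = (∫ a|_{ε_θ} · b|_{δ′_θ} dμ) · ζ` — the mixture touches only the
(3.2)·(3.3) part (14b's `commonBox_average_tStepLabel_eq_profile` identifies its common-box average at the record with the (η)-profiled label weight).
[cite: Balaban1988Convergent, (3.2)–(3.5) p.265, (3.16) p.268 (bookkeeping)] -/
theorem integral_ωOfRecordAt_eq (μ₂ : Measure Θ₂) (p : B12.RunParams) (g : ℕ → ℝ) (k : ℕ) (ε δ : Θ₂ → ℝ) (ζ : ZetaOfRecord F N ν M)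
    (s : SeqOfRecord F ν M g p.K k) (t : LbOfRecord F ν p g k) (U : GaugeField (F.P p.K) k (SU N))
    (V' : GaugeField (F.P p.K) (k + 1) (SU N)) :
    ∫ θ, ωOfRecordAt F N ν M p g k (ε θ) (δ θ) ζ s t U V' ∂μ₂
      = (∫ θ, aWeightAt F N ν M p g k (ε θ) s t.1 V' * bWeightAt F N ν M p g k (δ θ) s t.1 t.2.1 U V' ∂μ₂) *
          ζ p g k s t.1 t.2.1 t.2.2 U V' := by
  simp only [ωOfRecordAt]
  exact integral_mul_const _ _

/-- **THE INTEGRATED STEP WEIGHTS AT LETTERS ARE THE RESUMMED INTEGRATED LABEL WEIGHTS.**  For letter families `Θ′_θ`, `Δ_θ` (step `k` reads `Θ′` at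
level `k+1` and `Δ` at level `k`, as in def-T's `wOfRecordAt`) with every label weight integrable in `θ`:
`∫ wOfRecordAt (Θ′ θ) (Δ θ) ζ p g k s′ U V′ dμ = resumWeights σOfRecord (∫ ω|_{Θ′_θ(k+1), Δ_θ(k)} dμ) s′ U V′`.
[cite: Balaban1988Convergent, (3.2)–(3.5) p.265, §3 p.267 (bookkeeping)] -/
theorem integral_wOfRecordAt_eq (μ₂ : Measure Θ₂) (Θw Δw : Θ₂ → ThresholdLetter) (ζ : ZetaOfRecord F N ν M)
    (p : B12.RunParams) (g : ℕ → ℝ) (k : ℕ) (s' : SeqOfRecord F ν M g p.K (k + 1)) (U : GaugeField (F.P p.K) k (SU N))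
    (V' : GaugeField (F.P p.K) (k + 1) (SU N))
    (hint : ∀ t : LbOfRecord F ν p g k,
      Integrable (fun θ => ωOfRecordAt F N ν M p g k (Θw θ p g (k + 1)) (Δw θ p g k) ζ s'.init t U V') μ₂) :
    ∫ θ, wOfRecordAt F N ν M (Θw θ) (Δw θ) ζ p g k s' U V' ∂μ₂
      = resumWeights (σOfRecord F ν M p g k)
          (fun s t U V => ∫ θ, ωOfRecordAt F N ν M p g k (Θw θ p g (k + 1)) (Δw θ p g k) ζ s t U V ∂μ₂) s' U V' := by
  simp only [wOfRecordAt_apply]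
  exact integral_resumWeights_eq μ₂ _ (fun θ => ωOfRecordAt F N ν M p g k (Θw θ p g (k + 1)) (Δw θ p g k) ζ) s' U V' hint

/-! ## §2  The T-step of record at letters: the letter integral of the SHARP step is the step at the integrated factors -/

/-- **ONE BLOCK: THE WEIGHTS' LETTERS MIXED, THE FRONT FACTOR AT A FIXED LETTER `Θ₀`** (file 15 §4 `integral_tstepOfRecord_eq` at letters; the
record's pin is `Θ₀ := epsLetterOfRecord ν`, `tstepOfRecord_eq_at`).  For a `θ`-family of step weights jointly measurable in `(θ, U)` with `|w_θ| ≤ 1` and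
the level-`k` piece `χ_k|_{Θ₀(k)}(init s′)·T(init s′)` integrable along the averaging fibre at `V′`:
`∫ tstepOfRecordAt Θ₀ (w θ) p g k T s′ V′ dμ = tstepOfRecordAt Θ₀ w̄ p g k T s′ V′`, `w̄ p g k s U V := ∫ w_θ p g k s U V dμ`.
[cite: Balaban1988Convergent, (3.1) p.264, (3.24)–(3.25) p.270 (bookkeeping)] -/
theorem integral_tstepOfRecordAt_eq (μ₂ : Measure Θ₂) [IsFiniteMeasure μ₂] (Θ₀ : ThresholdLetter)
    (w : Θ₂ → StepWeightsOfRecord F N ν M) (p : B12.RunParams) (g : ℕ → ℝ) (k : ℕ)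
    (T : SeqOfRecord F ν M g p.K k → Density (F.P p.K) k (SU N)) (s' : SeqOfRecord F ν M g p.K (k + 1))
    (V' : GaugeField (F.P p.K) (k + 1) (SU N))
    (hwm : Measurable fun q : Θ₂ × GaugeField (F.P p.K) k (SU N) => w q.1 p g k s' q.2 V')
    (hwb : ∀ θ U, |w θ p g k s' U V'| ≤ 1)
    (hT : Integrable (fun U => chiSeqOfRecordAt F N ν M g p.K k (Θ₀ p g k) s'.init U * T s'.init U)
      (avgKernel (avOfRecord F N p.K k).avg V')) :
    ∫ θ, tstepOfRecordAt F N ν M Θ₀ (w θ) p g k T s' V' ∂μ₂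
      = tstepOfRecordAt F N ν M Θ₀ (fun p g k s U V => ∫ θ, w θ p g k s U V ∂μ₂) p g k T s' V' := by
  -- (†) with the old front factor absorbed into the slot: `(†)[χ, T, w] = (†)[1, χ·T, w]`, then file 15's one-block Fubini lemma
  have hre : ∀ w' : StepWeightsOfRecord F N ν M, tstepOfRecordAt F N ν M Θ₀ w' p g k T s' V'
      = texpASucc (avOfRecord F N p.K k).avg (fun _ _ => (1 : ℝ))
          (fun s U => chiSeqOfRecordAt F N ν M g p.K k (Θ₀ p g k) s U * T s U) (w' p g k) s' V' := by
    intro w'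
    rw [tstepOfRecordAt, texpASucc_apply, texpASucc_apply]
    congr 1
    exact integral_congr_ae (ae_of_all _ fun U => by beta_reduce; ring)
  simp_rw [hre]
  have hm : Measurable fun q : Θ₂ × GaugeField (F.P p.K) k (SU N) =>
      w q.1 p g k s' q.2 V' * (fun (_ : Θ₂) (_ : SeqOfRecord F ν M g p.K k) (_ : GaugeField (F.P p.K) k (SU N)) => (1 : ℝ))
        q.1 s'.init q.2 := by
    simpa using hwm
  have hC : ∀ (θ : Θ₂) (U : GaugeField (F.P p.K) k (SU N)),
      |w θ p g k s' U V' * (fun (_ : Θ₂) (_ : SeqOfRecord F ν M g p.K k) (_ : GaugeField (F.P p.K) k (SU N)) => (1 : ℝ))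
        θ s'.init U| ≤ 1 := fun θ U => by simpa using hwb θ U
  rw [integral_texpASucc_eq μ₂ (avOfRecord F N p.K k).avg (fun _ _ _ => (1 : ℝ)) _ (fun θ => w θ p g k) s' V' hm hC hT,
    texpASucc_apply]
  congr 1
  refine integral_congr_ae (ae_of_all _ fun U => ?_)
  simp only [mul_one, one_mul]

/-- ★ **SEPARATED BLOCKS AT def-T's NAMES.**  Letter families `Θ_{θ₁}` for the OLD front factor `χ_k|_{Θ(k)}` (block 1, finite measure `μ₁`) and a
`θ₂`-family of step weights `w_{θ₂} : StepWeightsOfRecord …` (block 2, finite measure `μ₂`), the front factor jointly measurable in `(θ₁, U)`, the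
weights jointly measurable in `(θ₂, U)` with `|w| ≤ 1` (def-T's `absW_le` shape), the slot `T(init s′)` integrable along the averaging fibre at `V′`:
`∫ tstepOfRecordAt (Θ θ₁) (w θ₂) p g k T s′ V′ d(μ₁ ⊗ μ₂) = texpASucc avg (∫ χ_k|_{Θ_θ(k)} dμ₁) T (∫ w_θ dμ₂) s′ V′` — file 15's
`integral_texpASucc_prod_eq` at the letters of record (`|χ_k|_ε| ≤ 1` is def-T's `abs_chiSeqOfRecordAt_le_one`).
[cite: Balaban1988Convergent, (3.1) p.264, (3.24)–(3.25) p.270 (bookkeeping)] -/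
theorem integral_tstepOfRecordAt_prod_eq (μ₁ : Measure Θ₁) (μ₂ : Measure Θ₂) [IsFiniteMeasure μ₁] [IsFiniteMeasure μ₂]
    (Θf : Θ₁ → ThresholdLetter) (w : Θ₂ → StepWeightsOfRecord F N ν M) (p : B12.RunParams) (g : ℕ → ℝ) (k : ℕ)
    (T : SeqOfRecord F ν M g p.K k → Density (F.P p.K) k (SU N)) (s' : SeqOfRecord F ν M g p.K (k + 1))
    (V' : GaugeField (F.P p.K) (k + 1) (SU N))
    (hχm : Measurable fun q : Θ₁ × GaugeField (F.P p.K) k (SU N) =>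
      chiSeqOfRecordAt F N ν M g p.K k (Θf q.1 p g k) s'.init q.2)
    (hwm : Measurable fun q : Θ₂ × GaugeField (F.P p.K) k (SU N) => w q.1 p g k s' q.2 V')
    (hwb : ∀ θ U, |w θ p g k s' U V'| ≤ 1)
    (hT : Integrable (T s'.init) (avgKernel (avOfRecord F N p.K k).avg V')) :
    ∫ θ, tstepOfRecordAt F N ν M (Θf θ.1) (w θ.2) p g k T s' V' ∂(μ₁.prod μ₂)
      = texpASucc (avOfRecord F N p.K k).avg (fun s U => ∫ θ, chiSeqOfRecordAt F N ν M g p.K k (Θf θ p g k) s U ∂μ₁) T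
          (fun s U V => ∫ θ, w θ p g k s U V ∂μ₂) s' V' := by
  simp only [tstepOfRecordAt]
  exact integral_texpASucc_prod_eq μ₁ μ₂ (avOfRecord F N p.K k).avg
    (fun θ => chiSeqOfRecordAt F N ν M g p.K k (Θf θ p g k)) T (fun θ => w θ p g k) s' V' hχm hwm
    (fun θ U => abs_chiSeqOfRecordAt_le_one F N ν M g p.K k _ _ _) hwb hT

/-- ★★ **THE MIXTURE ROAD AT THE LETTERS OF RECORD.**  Block 2 = the step weights AT LETTERS `wOfRecordAt (Θ′ θ₂) (Δ θ₂) ζ` (def-T), under the displayed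
ζ-size law `IsZetaAbsLeOne` (`|w| ≤ 1` is then def-T's `abs_wOfRecordAt_le_one`), every label weight integrable in `θ₂`: the letter integral of the
SHARP T-step of record is the T-step at the integrated front factor and the RESUMMED integrated label weights (`ζ` riding along, §1) —
`∫ tstepOfRecordAt (Θ θ₁) (wOfRecordAt (Θ′ θ₂) (Δ θ₂) ζ) p g k T s′ V′ d(μ₁ ⊗ μ₂)
   = texpASucc avg (∫ χ_k|_{Θ_θ(k)} dμ₁) T (resumWeights σOfRecord (∫ ω|_{Θ′_θ(k+1), Δ_θ(k)} dμ₂)) s′ V′`.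
The record is the diagonal (Dirac families at `epsLetterOfRecord`, `twoDeltaLetterOfRecord`; def-T's `tstepOfRecord_eq_at`, `wOfRecord_eq_at`).
CONDITIONAL on the displayed measurability ∕ integrability binders. [cite: Balaban1988Convergent, (3.1)–(3.5) pp.264–265, (3.24)–(3.25) p.270 (bookkeeping)] -/
theorem integral_tstepOfRecordAt_wOfRecordAt_prod_eq (μ₁ : Measure Θ₁) (μ₂ : Measure Θ₂) [IsFiniteMeasure μ₁] [IsFiniteMeasure μ₂]
    (Θf : Θ₁ → ThresholdLetter) (Θw Δw : Θ₂ → ThresholdLetter) {ζ : ZetaOfRecord F N ν M} (hζ : IsZetaAbsLeOne F N ν M ζ)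
    (p : B12.RunParams) (g : ℕ → ℝ) (k : ℕ) (T : SeqOfRecord F ν M g p.K k → Density (F.P p.K) k (SU N))
    (s' : SeqOfRecord F ν M g p.K (k + 1)) (V' : GaugeField (F.P p.K) (k + 1) (SU N))
    (hχm : Measurable fun q : Θ₁ × GaugeField (F.P p.K) k (SU N) =>
      chiSeqOfRecordAt F N ν M g p.K k (Θf q.1 p g k) s'.init q.2)
    (hwm : Measurable fun q : Θ₂ × GaugeField (F.P p.K) k (SU N) =>
      wOfRecordAt F N ν M (Θw q.1) (Δw q.1) ζ p g k s' q.2 V')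
    (hT : Integrable (T s'.init) (avgKernel (avOfRecord F N p.K k).avg V'))
    (hint : ∀ (s : SeqOfRecord F ν M g p.K (k + 1)) (U : GaugeField (F.P p.K) k (SU N)) (V : GaugeField (F.P p.K) (k + 1) (SU N))
      (t : LbOfRecord F ν p g k),
      Integrable (fun θ => ωOfRecordAt F N ν M p g k (Θw θ p g (k + 1)) (Δw θ p g k) ζ s.init t U V) μ₂) :
    ∫ θ, tstepOfRecordAt F N ν M (Θf θ.1) (wOfRecordAt F N ν M (Θw θ.2) (Δw θ.2) ζ) p g k T s' V' ∂(μ₁.prod μ₂)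
      = texpASucc (avOfRecord F N p.K k).avg (fun s U => ∫ θ, chiSeqOfRecordAt F N ν M g p.K k (Θf θ p g k) s U ∂μ₁) T
          (fun s U V => resumWeights (σOfRecord F ν M p g k)
            (fun s t U V => ∫ θ, ωOfRecordAt F N ν M p g k (Θw θ p g (k + 1)) (Δw θ p g k) ζ s t U V ∂μ₂) s U V) s' V' := by
  have hw : (fun s U V => ∫ θ, wOfRecordAt F N ν M (Θw θ) (Δw θ) ζ p g k s U V ∂μ₂)
      = fun s U V => resumWeights (σOfRecord F ν M p g k)
          (fun s t U V => ∫ θ, ωOfRecordAt F N ν M p g k (Θw θ p g (k + 1)) (Δw θ p g k) ζ s t U V ∂μ₂) s U V := by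
    funext s U V
    exact integral_wOfRecordAt_eq F N ν M μ₂ Θw Δw ζ p g k s U V (hint s U V)
  rw [integral_tstepOfRecordAt_prod_eq F N ν M μ₁ μ₂ Θf (fun θ => wOfRecordAt F N ν M (Θw θ) (Δw θ) ζ) p g k T s' V' hχm hwm
    (fun θ U => abs_wOfRecordAt_le_one F N ν M _ _ hζ p g k s' U V') hT, hw]

end AtLetters

/-! ## §3  Scalar letters are the CONSTANT-VECTOR sub-box of the per-cube common box: 14b's sharp products at letters -/

section Products

open T4Continuum T4IndicatorShell T4LipschitzLedger B14.Sect3Decomp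
open Summit.QuantumFields.YangMills.Theorems.N21ThresholdMixtureTStepChi (chiNext_sdiff_mul_chiNextc_eq_prod_fac
  chiPrime_sdiff_mul_chiPrimec_eq_prod_fac)

variable (F : T4Family) (N : ℕ) [NeZero N] (ν : Stage7Numerics) (M : ℕ) (p : B12.RunParams) (g : ℕ → ℝ) (k : ℕ)

/-- **THE (3.2) LABEL WEIGHT AT A LETTER IS A SHARP MIXED PRODUCT AT THE CONSTANT THRESHOLD VECTOR `ε η_{k+1}²`** (14b's
`aWeight_eq_prod_fac_smallInd` with `ε_{k+1}` a letter; the record is the instance `ε := epsOfRecord ν g (k+1)` by def-T's `aWeight_eq_at`): for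
`P ⊆ cubes32 s` and `0 < ε η_{k+1}²`, `a|_ε(P)(V′) = ∏_{□′ ∈ cubes32 s} (if □′ ∈ P then large else small).fac (smallInd (u_{□′}(V′)) (ε η²))` with 14a's
block-sup tested variable — so a scalar-letter family is the DIAGONAL-IN-CUBES sub-family of the per-cube threshold vectors of 13b∕14a∕14b.
[cite: Balaban1988Convergent, (3.2) p.265] -/
theorem aWeightAt_eq_prod_fac_smallInd {ε : ℝ} (hε : 0 < ε * (F.P p.K).eta (k + 1) ^ 2) (s : SeqOfRecord F ν M g p.K k)
    {Pl : Finset (Iχ F ν p g k)} (hPl : Pl ⊆ cubes32 F ν M p g k s) (V' : GaugeField (F.P p.K) (k + 1) (SU N)) :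
    aWeightAt F N ν M p g k ε s Pl V' =
      ∏ c ∈ cubes32 F ν M p g k s, (if c ∈ Pl then Pol.large else Pol.small).fac
        (smallInd (⨆ q : ↥((sect3DataOfRecord F N ν M p g k s).plaqT c),
          dist1 (GaugeField.plaqHol ((sect3DataOfRecord F N ν M p g k s).UkLoc c V') q.1))
          (ε * (F.P p.K).eta (k + 1) ^ 2)) := by
  unfold aWeightAt
  rw [if_pos hPl]
  exact chiNext_sdiff_mul_chiNextc_eq_prod_fac (sect3DataOfRecord F N ν M p g k s) hε hPl V'

/-- **THE (3.3) LABEL WEIGHT AT A LETTER IS A SHARP MIXED PRODUCT AT THE CONSTANT THRESHOLD VECTOR `δ′`** (14b's `bWeight_eq_prod_fac_smallInd` with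
`2δ_k` a letter; the record is the instance `δ′ := 2·deltaOfRecord ν g k A₁` by def-T's `bWeight_eq_at`): for `Q ⊆ qcubes s P` and `0 < δ′`.
[cite: Balaban1988Convergent, (3.3)–(3.4) p.265] -/
theorem bWeightAt_eq_prod_fac_smallInd {δ' : ℝ} (hδ : 0 < δ') (s : SeqOfRecord F ν M g p.K k) (Pl : Finset (Iχ F ν p g k))
    {Ql : Finset (Iχ F ν p g k)} (hQl : Ql ⊆ qcubes F ν M p g k s Pl)
    (U : GaugeField (F.P p.K) k (SU N)) (V' : GaugeField (F.P p.K) (k + 1) (SU N)) :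
    bWeightAt F N ν M p g k δ' s Pl Ql U V' =
      ∏ c ∈ qcubes F ν M p g k s Pl, (if c ∈ Ql then Pol.large else Pol.small).fac
        (smallInd (⨆ b : ↥((sect3DataOfRecord F N ν M p g k s).bondsStar c),
          dist1 (U b.1 * (Vbox (sect3DataOfRecord F N ν M p g k s) (avOfRecord F N p.K) c V' b.1)⁻¹)) δ') := by
  unfold bWeightAt
  rw [if_pos hQl]
  exact chiPrime_sdiff_mul_chiPrimec_eq_prod_fac (sect3DataOfRecord F N ν M p g k s) (avOfRecord F N p.K) hδ hQl U V'

/-- ★ **THE (3.2)·(3.3) PART OF THE LABEL WEIGHT AT LETTERS `(ε, δ′)` IS ONE SHARP PRODUCT OVER THE STEP's OCCURRENCE LIST `cubes32 s ⊕ qcubes s P`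
READ AT THE CONSTANT-PER-KIND THRESHOLD VECTOR `Sum.elim (· ↦ ε η²) (· ↦ δ′)`** (14b's `aWeight_mul_bWeight_eq_prod_fac_disjSum` at letters).  Hence a
letter family `(ε_θ, δ′_θ)` is the sub-family `S_θ = Sum.elim (· ↦ ε_θ η²) (· ↦ δ′_θ)` of the per-OCCURRENCE threshold vectors of 14a∕14b — the located
gap between def-T's scalar letters and the mixture road's one-multiplier-per-occurrence box, stated in kernel form. [cite: Balaban1988Convergent, (3.2)–(3.5) p.265] -/
theorem aWeightAt_mul_bWeightAt_eq_prod_fac_disjSum {ε δ' : ℝ} (hε : 0 < ε * (F.P p.K).eta (k + 1) ^ 2) (hδ : 0 < δ')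
    (s : SeqOfRecord F ν M g p.K k) {Pl Ql : Finset (Iχ F ν p g k)}
    (hPl : Pl ⊆ cubes32 F ν M p g k s) (hQl : Ql ⊆ qcubes F ν M p g k s Pl)
    (U : GaugeField (F.P p.K) k (SU N)) (V' : GaugeField (F.P p.K) (k + 1) (SU N)) :
    aWeightAt F N ν M p g k ε s Pl V' * bWeightAt F N ν M p g k δ' s Pl Ql U V' =
      ∏ x ∈ (cubes32 F ν M p g k s).disjSum (qcubes F ν M p g k s Pl),
        (Sum.elim (fun c => if c ∈ Pl then Pol.large else Pol.small) (fun c => if c ∈ Ql then Pol.large else Pol.small) x).fac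
          (smallInd
            (Sum.elim
              (fun c => ⨆ q : ↥((sect3DataOfRecord F N ν M p g k s).plaqT c),
                dist1 (GaugeField.plaqHol ((sect3DataOfRecord F N ν M p g k s).UkLoc c V') q.1))
              (fun c => ⨆ b : ↥((sect3DataOfRecord F N ν M p g k s).bondsStar c),
                dist1 (U b.1 * (Vbox (sect3DataOfRecord F N ν M p g k s) (avOfRecord F N p.K) c V' b.1)⁻¹)) x)
            (Sum.elim (fun _ => ε * (F.P p.K).eta (k + 1) ^ 2) (fun _ => δ') x)) := by
  rw [Finset.prod_disjSum, aWeightAt_eq_prod_fac_smallInd F N ν M p g k hε s hPl V',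
    bWeightAt_eq_prod_fac_smallInd F N ν M p g k hδ s Pl hQl U V']
  rfl

end Products

end Summit.QuantumFields.YangMills.Theorems.N21ThresholdMixtureAtLetters

end
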